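import Summits.CriticalPhenomena.CardyFormulaZ2.Theorems.CardyFlipRussoSquareFromVoronoiHubDilutionDefs
import Summits.CriticalPhenomena.CardyFormulaZ2.Theorems.CardyFlipRussoVoronoiHubFromSmirnovGeneralPosition
import Literature.Analysis.FunctionSpaces.PoissonSuperpositionProofs
import Mathlib.MeasureTheory.Measure.Prod
import Mathlib.MeasureTheory.Measure.Lebesgue.Complex
import Mathlib.Probability.Distributions.SetBernoulli
import HarnessLib

/-!
# Stub `stub_dilutionHypothesisEnd` of line `poisson-dilution-leg`, crux `SquareFromVoronoiHub`
# (stmt-CriticalPhenomena-6434, route `CardyFlipRusso`, sub-problem `CardyFormulaZ2`)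

The HYPOTHESIS END (`t = 1`) of the Poisson-dilution leg of
`…CardyFlipRussoSquareFromVoronoiHubDilutionDefs.lean`.  At parameter `t = 1` the presence law of the
lattice sites is `sitePercolation (ℤ × ℤ) (σ 1) = sitePercolation _ 0 = dirac ∅`
(`unitInterval.symm_one`, Mathlib's `ProbabilityTheory.setBernoulli_zero`), so almost surely NO lattice
site is present (`ae_latticeEmpty`); and the superposition `ω.1.1.1 ∪ ω.1.1.2` of the two independent
Poisson processes of black and white nuclei of Lebesgue intensity is a Poisson process of intensity
`volume + volume` (Kingman's Superposition Theorem, `IsPoissonPointProcess.superposition_holds`), which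
is σ-finite and `≪ volume`, so almost surely no four distinct nuclei are cocircular or collinear
(`poisson_ae_noCocircularFour`, Benjamini–Schramm general position) and in particular there is NO hub
(a hub `p` has at least four nuclei at distance `infDist p (nuclei ω)` from `p`: four distinct
cospherical points; `hubs_eq_empty_of_noFour`).  On this co-null event the leg's black region is the
plain closed black Voronoi region `blackRegion ω.1.1.1 ω.1.1.2` of the Poisson nuclei
(`legBlackRegion_eq_of_good`), so the leg's crossing event `legCrossing R δ` coincides almost surely
with the cylinder over the crux's Poisson–Voronoi crossing event (`legCrossing_ae_eq_cylinder`); by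
`measure_congr` and `Measure.prod_prod` (neither needs the crossing event to be measurable)
`legProb 1 PB PW R δ = voronoiCrossingProb PB PW R δ` for EVERY `R`, `δ`
(`legProb_one_eq_voronoiCrossingProb`), and Cardy's formula transfers verbatim: the registered stub
`stub_dilutionHypothesisEnd`.

References: B. Bollobás, O. Riordan, *Percolation* (CUP 2006), Ch. 8 §§8.1–8.2 (two-coloured random
Voronoi tessellations, crossing events); J. F. C. Kingman, *Poisson Processes* (1993), §2.2
(Superposition Theorem); I. Benjamini, O. Schramm, Comm. Math. Phys. 197 (1998), §2 (almost sure
general position of Poisson nuclei).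
-/

noncomputable section

open scoped Topology
open MeasureTheory Metric Set Filter
open Literature.Analysis.FunctionSpaces (PointConfig IsPoissonPointProcess
  existsUnique_isPoissonPointProcess_holds)
open Literature.Probability.Percolation (SiteConfig sitePercolation half blackRegion voronoiCrossing)
open Literature.Probability.RandomPlanarGeometry (ConformalRectangle cardyFunction crossRatio)
open Summit.CriticalPhenomena.CardyFormulaZ2.Cruxes.SquareFromVoronoiHub.VoronoiBlocks
  (zGs Gs crudeCrossing siteCrossingProb voronoiCrossingProb squareFromVoronoiHub_iff)

namespace Summit.CriticalPhenomena.CardyFormulaZ2.Cruxes.SquareFromVoronoiHub.PoissonDilutionLeg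

open MeasureTheory.Measure (QuasiMeasurePreserving)
open Summit.CriticalPhenomena.CardyFormulaZ2.Cruxes.VoronoiHubFromSmirnov.MoebiusExactDelaunayDilationWard
  (poisson_ae_noCocircularFour)

/-! ### Counting: `n` distinct points out of a set with `n ≤ encard` -/

/-- A set of extended cardinality at least `n` contains the range of an injective map from `Fin n`.
[folklore] -/
theorem exists_injective_of_le_encard {α : Type*} {s : Set α} {n : ℕ}
    (h : (n : ℕ∞) ≤ s.encard) : ∃ f : Fin n → α, Function.Injective f ∧ ∀ j, f j ∈ s := by
  -- adapted from `SoftMachine.le_encard_iff_exists_injective`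
  -- (Theorems/CardyMagicRigidityNestingRigiditySoftMachineCounting.lean)
  classical
  obtain ⟨t, hts, ht⟩ := Set.exists_subset_encard_eq h
  have htfin : t.Finite := Set.finite_of_encard_eq_coe ht
  have hcard : htfin.toFinset.card = n := by
    have := htfin.encard_eq_coe_toFinset_card
    rw [ht] at this
    exact_mod_cast this.symm
  set e := htfin.toFinset.equivFinOfCardEq hcard
  refine ⟨fun j ↦ (e.symm j).1, fun j l hjl ↦ e.symm.injective (Subtype.ext hjl), fun j ↦ hts ?_⟩
  exact htfin.mem_toFinset.1 (e.symm j).2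

/-! ### On the good event: no lattice site, no four cocircular nuclei -/

/-- With no lattice site present, the black nuclei are the black Poisson nuclei. [folklore] -/
theorem blackNuclei_eq_of_latticeEmpty {ω : LegConfig} (h : ω.1.2.1 = ∅) :
    blackNuclei ω = (ω.1.1.1 : Set ℂ) := by
  simp [blackNuclei, h]

/-- With no lattice site present, the white nuclei are the white Poisson nuclei. [folklore] -/
theorem whiteNuclei_eq_of_latticeEmpty {ω : LegConfig} (h : ω.1.2.1 = ∅) :
    whiteNuclei ω = (ω.1.1.2 : Set ℂ) := by
  simp [whiteNuclei, h]

/-- With no lattice site present, the nuclei are the points of the superposition `ω.1.1.1 ∪ ω.1.1.2`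
of the two Poisson configurations. [folklore] -/
theorem mem_nuclei_iff_of_latticeEmpty {ω : LegConfig} (h : ω.1.2.1 = ∅) (n : ℂ) :
    n ∈ nuclei ω ↔ n ∈ ω.1.1.1 ∪ ω.1.1.2 := by
  rw [nuclei, blackNuclei_eq_of_latticeEmpty h, whiteNuclei_eq_of_latticeEmpty h]
  rfl

/-- **No hub in general position.**  If no lattice site is present and no four distinct points of
the superposition `ω.1.1.1 ∪ ω.1.1.2` are cocircular or collinear, there is no hub: a hub `p` has at
least four nuclei at the common distance `infDist p (nuclei ω)` from `p`, i.e. four distinct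
cospherical nuclei. [folklore] -/
theorem hubs_eq_empty_of_noFour {ω : LegConfig} (h : ω.1.2.1 = ∅)
    (h4 : ¬ ∃ x : Fin 4 → ℂ, Function.Injective x ∧ (∀ i, x i ∈ ω.1.1.1 ∪ ω.1.1.2) ∧
      (EuclideanGeometry.Cospherical (Set.range x) ∨ Collinear ℝ (Set.range x))) :
    hubs ω = ∅ := by
  refine eq_empty_iff_forall_notMem.2 fun p hp => h4 ?_
  have hp' : ((4 : ℕ) : ℕ∞) ≤
      ({n : ℂ | n ∈ nuclei ω ∧ dist p n = infDist p (nuclei ω)}).encard := by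
    exact_mod_cast hp
  obtain ⟨f, hf, hfS⟩ := exists_injective_of_le_encard hp'
  refine ⟨f, hf, fun i => (mem_nuclei_iff_of_latticeEmpty h (f i)).1 (hfS i).1, Or.inl ?_⟩
  refine ⟨p, infDist p (nuclei ω), ?_⟩
  rintro _ ⟨i, rfl⟩
  rw [dist_comm]
  exact (hfS i).2

/-- **The leg's black region on the good event** is the plain closed black Voronoi region of the
Poisson nuclei: no lattice nuclei, and no hub to remove. [cite: BollobasRiordan2006, Ch. 8 §8.1] -/
theorem legBlackRegion_eq_of_good {ω : LegConfig} (h : ω.1.2.1 = ∅)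
    (h4 : ¬ ∃ x : Fin 4 → ℂ, Function.Injective x ∧ (∀ i, x i ∈ ω.1.1.1 ∪ ω.1.1.2) ∧
      (EuclideanGeometry.Cospherical (Set.range x) ∨ Collinear ℝ (Set.range x))) :
    legBlackRegion ω = blackRegion (ω.1.1.1 : Set ℂ) (ω.1.1.2 : Set ℂ) := by
  rw [legBlackRegion, blackNuclei_eq_of_latticeEmpty h, whiteNuclei_eq_of_latticeEmpty h,
    hubs_eq_empty_of_noFour h h4]
  simp

/-! ### The good event is almost sure at `t = 1` -/

/-- At `t = 1` the presence law is `Bernoulli(0)` (`σ 1 = 0`, `setBernoulli_zero`): almost surely no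
lattice site is present. [folklore] -/
theorem ae_latticeEmpty (PB PW : Measure (PointConfig ℂ)) :
    ∀ᵐ ω ∂(legMeasure 1 PB PW), ω.1.2.1 = ∅ := by
  have hq : QuasiMeasurePreserving (fun ω : LegConfig => ω.1.2.1) (legMeasure 1 PB PW)
      (sitePercolation (ℤ × ℤ) (unitInterval.symm 1)) := by
    unfold legMeasure
    exact (Measure.quasiMeasurePreserving_fst.comp Measure.quasiMeasurePreserving_snd).comp
      Measure.quasiMeasurePreserving_fst
  refine hq.ae (p := fun s : SiteConfig (ℤ × ℤ) => s = ∅) ?_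
  have h0 : sitePercolation (ℤ × ℤ) (unitInterval.symm 1) = Measure.dirac ∅ := by
    rw [unitInterval.symm_one, sitePercolation, ProbabilityTheory.setBernoulli_zero]
  rw [h0, ae_dirac_eq]
  exact Filter.eventually_pure.2 rfl

/-- For two independent Poisson processes of Lebesgue intensity, almost surely no four distinct
points of their superposition are cocircular or collinear: the superposition is a Poisson process
of intensity `volume + volume` (Kingman's Superposition Theorem), σ-finite and `≪ volume`, and the
almost sure general position of such a process (Benjamini–Schramm). [folklore] -/
theorem ae_noFour_prod {PB PW : Measure (PointConfig ℂ)}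
    (hB : IsPoissonPointProcess (volume : Measure ℂ) PB)
    (hW : IsPoissonPointProcess (volume : Measure ℂ) PW) :
    ∀ᵐ c ∂(PB.prod PW), ¬ ∃ x : Fin 4 → ℂ, Function.Injective x ∧ (∀ i, x i ∈ c.1 ∪ c.2) ∧
      (EuclideanGeometry.Cospherical (Set.range x) ∨ Collinear ℝ (Set.range x)) := by
  have hsup : IsPoissonPointProcess ((volume : Measure ℂ) + volume)
      ((PB.prod PW).map fun p : PointConfig ℂ × PointConfig ℂ => p.1 ∪ p.2) :=
    Literature.Analysis.FunctionSpaces.IsPoissonPointProcess.superposition_holds (E := ℂ) hB hW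
  have hac : ((volume : Measure ℂ) + volume) ≪ (volume : Measure ℂ) :=
    Measure.AbsolutelyContinuous.add_left Measure.AbsolutelyContinuous.rfl
      Measure.AbsolutelyContinuous.rfl
  have h0 := poisson_ae_noCocircularFour hsup hac
  have hU : Measurable fun p : PointConfig ℂ × PointConfig ℂ => p.1 ∪ p.2 :=
    PointConfig.measurable_union'
  have h1 := ae_of_ae_map hU.aemeasurable (measure_eq_zero_iff_ae_notMem.1 h0)
  filter_upwards [h1] with c hc
  exact hc

/-- At `t = 1`, under the annealed law of the leg with Poisson pair of Lebesgue intensity, almost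
surely no four distinct points of the superposition of the two Poisson configurations are
cocircular or collinear. [folklore] -/
theorem ae_noFour {PB PW : Measure (PointConfig ℂ)}
    (hB : IsPoissonPointProcess (volume : Measure ℂ) PB)
    (hW : IsPoissonPointProcess (volume : Measure ℂ) PW) :
    ∀ᵐ ω ∂(legMeasure 1 PB PW), ¬ ∃ x : Fin 4 → ℂ, Function.Injective x ∧
      (∀ i, x i ∈ ω.1.1.1 ∪ ω.1.1.2) ∧
      (EuclideanGeometry.Cospherical (Set.range x) ∨ Collinear ℝ (Set.range x)) := by
  have hq : QuasiMeasurePreserving (fun ω : LegConfig => ω.1.1) (legMeasure 1 PB PW)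
      (PB.prod PW) := by
    unfold legMeasure
    exact Measure.quasiMeasurePreserving_fst.comp Measure.quasiMeasurePreserving_fst
  exact hq.ae (p := fun c : PointConfig ℂ × PointConfig ℂ => ¬ ∃ x : Fin 4 → ℂ,
    Function.Injective x ∧ (∀ i, x i ∈ c.1 ∪ c.2) ∧
      (EuclideanGeometry.Cospherical (Set.range x) ∨ Collinear ℝ (Set.range x))) (ae_noFour_prod hB hW)

/-- **At `t = 1` the leg's black region is almost surely the closed black Voronoi region of the
Poisson nuclei.** [cite: BollobasRiordan2006, Ch. 8 §8.1] -/
theorem ae_legBlackRegion_eq {PB PW : Measure (PointConfig ℂ)}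
    (hB : IsPoissonPointProcess (volume : Measure ℂ) PB)
    (hW : IsPoissonPointProcess (volume : Measure ℂ) PW) :
    ∀ᵐ ω ∂(legMeasure 1 PB PW), legBlackRegion ω = blackRegion (ω.1.1.1 : Set ℂ) (ω.1.1.2 : Set ℂ) := by
  filter_upwards [ae_latticeEmpty PB PW, ae_noFour hB hW] with ω h h4
  exact legBlackRegion_eq_of_good h h4

/-! ### The heart: at `t = 1` the leg probability IS the crux's hypothesis probability -/

/-- At `t = 1` the leg's crossing event agrees almost surely with the cylinder over the crux's
Poisson–Voronoi crossing event of the two Poisson configurations. [cite: BollobasRiordan2006, Ch. 8 §8.2] -/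
theorem legCrossing_ae_eq_cylinder {PB PW : Measure (PointConfig ℂ)}
    (hB : IsPoissonPointProcess (volume : Measure ℂ) PB)
    (hW : IsPoissonPointProcess (volume : Measure ℂ) PW) (R : ConformalRectangle) (δ : ℝ) :
    legCrossing R δ =ᵐ[legMeasure 1 PB PW]
      (({c : PointConfig ℂ × PointConfig ℂ |
          voronoiCrossing R.carrier (R.arc 0) (R.arc 2) δ (c.1 : Set ℂ) (c.2 : Set ℂ)} ×ˢ
          (univ : Set (SiteConfig (ℤ × ℤ) × SiteConfig (ℤ × ℤ)))) ×ˢ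
        (univ : Set (SiteConfig (ℚ × ℚ)))) := by
  refine eventuallyEq_set.2 ?_
  filter_upwards [ae_legBlackRegion_eq hB hW] with ω hω
  simp only [legCrossing, mem_setOf_eq, hω, mem_prod, mem_univ, and_true]
  rfl

/-- **The `t = 1` leg is the hypothesis model.**  For a Poisson pair of Lebesgue intensity and every
conformal rectangle `R` and mesh `δ`, `legProb 1 PB PW R δ = voronoiCrossingProb PB PW R δ` (outer
measures: the two events agree almost surely, `measure_congr`; the cylinder factors by
`Measure.prod_prod`). [cite: BollobasRiordan2006, Ch. 8 §8.2] -/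
theorem legProb_one_eq_voronoiCrossingProb {PB PW : Measure (PointConfig ℂ)}
    (hB : IsPoissonPointProcess (volume : Measure ℂ) PB)
    (hW : IsPoissonPointProcess (volume : Measure ℂ) PW) (R : ConformalRectangle) (δ : ℝ) :
    legProb 1 PB PW R δ = voronoiCrossingProb PB PW R δ := by
  unfold legProb voronoiCrossingProb
  simp only [measureReal_def]
  congr 1
  rw [measure_congr (legCrossing_ae_eq_cylinder hB hW R δ), legMeasure, Measure.prod_prod,
    Measure.prod_prod, measure_univ, measure_univ, mul_one, mul_one]

/-- **The hypothesis end as functions of the mesh**: `legProb 1 PB PW R = voronoiCrossingProb PB PW R`.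
[folklore] -/
theorem legProb_one_eq {PB PW : Measure (PointConfig ℂ)}
    (hB : IsPoissonPointProcess (volume : Measure ℂ) PB)
    (hW : IsPoissonPointProcess (volume : Measure ℂ) PW) (R : ConformalRectangle) :
    legProb 1 PB PW R = voronoiCrossingProb PB PW R :=
  funext fun δ => legProb_one_eq_voronoiCrossingProb hB hW R δ

/-! ### Registered stub -/

/-- **Registered stub `stub_dilutionHypothesisEnd` (the `t = 1` end of the Poisson-dilution leg is
the hypothesis).**  For Poisson laws of Lebesgue intensity the presence law is `Bernoulli(0)`
(`unitInterval.symm 1 = 0`, `setBernoulli_zero`: the lattice part is a.s. empty), hubs a.s. do not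
occur (no four points of the superposition `PB ∪ PW` — a Poisson process of intensity `2 · volume` by
`superposition_holds` — are cocircular, `poisson_ae_noCocircularFour`), so `legCrossing R δ` agrees
with the cylinder over the hypothesis event up to a null set and
`legProb 1 PB PW R = voronoiCrossingProb PB PW R` (`Measure.prod_prod`, no measurability needed);
Cardy's formula for the crux's hypothesis sequence IS Cardy's formula for the `t = 1` leg
probabilities. [cite: BollobasRiordan2006, Ch. 8 §8.2] -/
theorem stub_dilutionHypothesisEnd : (∀ (PB PW : Measure (PointConfig ℂ)),
      IsPoissonPointProcess (volume : Measure ℂ) PB → IsPoissonPointProcess (volume : Measure ℂ) PW →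
      ∀ R : ConformalRectangle, R.HasCrossingLimit (voronoiCrossingProb PB PW R) cardyFunction) →
    ∀ (PB PW : Measure (PointConfig ℂ)),
      IsPoissonPointProcess (volume : Measure ℂ) PB → IsPoissonPointProcess (volume : Measure ℂ) PW →
      ∀ R : ConformalRectangle, R.HasCrossingLimit (legProb 1 PB PW R) cardyFunction := by
  intro hV PB PW hB hW R
  rw [legProb_one_eq hB hW R]
  exact hV PB PW hB hW R

end Summit.CriticalPhenomena.CardyFormulaZ2.Cruxes.SquareFromVoronoiHub.PoissonDilutionLeg

end
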